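import Literature.NumberTheory.ModularSymbols.FullLevelHomologyTwistComparison
import Literature.NumberTheory.ModularSymbols.FullLevelHomologyTorusProjector
import HarnessLib

/-!
# The period-to-model transfer maps `β_W`, `β_V` of the K-line, built from the full-level carrier and an equivariant map
# `Ψ : Λ_Q(f) → V`, and their properties modulo the two spread-kernel hypotheses

Topic `Literature/NumberTheory/ModularSymbols`; namespace `Literature.NumberTheory.ModularSymbols.FullLevel`; sequel of
`FullLevelHomologyTwistComparison` (`twistComparison`), `FullLevelHomologyTorusProjector` (`eigProj`, `modelProj`) and
`FullLevelHomologySpreadLattice` (`spreadLattice = Λ_Q(f)`, `torusPeriodClass`).  Definitions with bodies + proved theorems;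
no named fact, no `sorry`, no instance, no notation.  Nothing about any elliptic curve is asserted; the two SPREAD-KERNEL
statements below are HYPOTHESES of the theorems that use them (their discharge — Knapp's presentation for the twisted one,
multiplicity one for the untwisted one — is the business of other files):

  `SpreadKernelHyp k p M hpM f      : ∀ z ∈ H₁(…)^{T̃}, torusPeriodClass f z = 0 → Π_f z = 0`
  `TwistedSpreadKernelHyp … f θ     : ∀ z ∈ H₁(…)^{T̃}, torusInvariantsToCuspidal z = 0 → Π_f (M_θ z) = 0`.

Given a `k`-module `V` with a `GL₂(ℤ/p)`-representation `σ` and a `k`-linear `Ψ : Λ_Q(f) → V` intertwining right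
translation with `σ` (`IsEquivariantOnSpread`):

* `liftInv` (a chosen `T̃`-invariant lift of `1 ⊗ φ ∈ H(p²M; k)` through the dictionary), `torusInvariantsToCuspidal_liftInv`;
* **`transferW Ψ φ := Ψ(Π_f(lift φ))`**, **`transferV Ψ θ φ := Ψ(Π_f(M_θ lift φ))`**;
* `spreadPeriod_eq_of_cuspidal_eq` / `spreadPeriod_coeffTwist_eq_of_cuspidal_eq` (well-definedness modulo the hypotheses);
  `transferW_add`, `transferV_add`; **`transferW_eq_zero_of_apply_eq_zero`** (`φ(f) = 0 ⇒ β_W φ = 0`);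
  **`transferW_mem_torusInvariants`** (`σ(diag)β_W φ = β_W φ`), **`transferV_mem_torusEigenspace`**;
  **`transferW_twistDown`**: `β_W(T_χ φ) = Σ_a θ(a)·σ(u(a)) (β_V φ)` (from `twistComparison`);
  **`card_smul_mem_span_transferV`**: `|T̃|·v ∈ k·β_V(Λ)` for every `v ∈ range Ψ` with `Σ_t θ(det t)σ(t⁻¹)v = |T̃|·v`
  (from the torus projector).

Consumer: route BSD/TeichmullerTwistDescent, crux `TwistedPeriodLatticeSaturation` — with `V` the Bruhat-coordinate model
`coordRep (ω̃^{p−1−b}) (ω̃ᵇ)` these are exactly the fields (D3)–(D5) of the homology-level tame-type lattice datum.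

## References
* A. Ash, G. Stevens, Duke Math. J. 53 (1986), §1 (1.2)–(1.4). [AshStevens1986]
* G. Stevens, Invent. Math. 98 (1989), Lemma (5.4) p. 97. [Stevens1989]
* J.-P. Serre, *Linear Representations of Finite Groups* (1977), §2.6. [Serre1977]
-/

noncomputable section

namespace Literature.NumberTheory.ModularSymbols

namespace FullLevel

open scoped MatrixGroups TensorProduct
open CategoryTheory CongruenceSubgroup groupHomology Finsupp Matrix
open Literature.Algebra.Homology
open Literature.NumberTheory.EllipticCurves.ModularForms
open Literature.RepresentationTheory.FiniteGroups

variable (k : Type) [CommRing k] (p M : ℕ) [Fact p.Prime] (hpM : Nat.Coprime p M) [NeZero M]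
  [Fintype (diagTorus (ZMod p))] [Invertible (Fintype.card (diagTorus (ZMod p)) : k)]
  (f : CuspForm (Gamma0 (p ^ 2 * M)) 2)

/-! ### The two spread-kernel hypotheses -/

/-- **Spread-kernel hypothesis** (untwisted): a `T̃`-invariant class whose `f`-period class vanishes has zero spread
(«`Λ_Q(f)^{T̃} ≅ Λ_f ⊗ k` via evaluation at `1`»: Eisenstein kernel + multiplicity one for `f`). A hypothesis, not a theorem
of this file. [cite: AshStevens1986, §1 (1.3)] -/
def SpreadKernelHyp : Prop :=
  ∀ z : PermutationCoeff.H1Invariants k (redGL p M) (diagTorus (ZMod p)),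
    torusPeriodClass k p M hpM f z = 0 → spreadPeriod k p M hpM f (z : H1carrier k p M) = 0

/-- **Twisted spread-kernel hypothesis**: a `T̃`-invariant class dying in `H(p²M; k)` (Eisenstein/torsion kernel of the
dictionary) has `Π_f(M_θ z) = 0`.  A hypothesis, not a theorem of this file (it follows from Knapp's presentation, sequel).
[cite: AshStevens1986, §1 (1.3)] -/
def TwistedSpreadKernelHyp (θ : (ZMod p)ˣ →* kˣ) : Prop :=
  ∀ z : PermutationCoeff.H1Invariants k (redGL p M) (diagTorus (ZMod p)),
    torusInvariantsToCuspidal k p M hpM z = 0 → spreadPeriod k p M hpM f (H1coeffTwist k p M θ (z : H1carrier k p M)) = 0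

/-! ### Spreads as elements of `Λ_Q(f)`; well-definedness lemmas -/

/-- The spread of a class as an element of `Λ_Q(f)`. [cite: AshStevens1986, §1 (1.3)] -/
def spreadElt (z : H1carrier k p M) : spreadLattice k p M hpM f := ⟨spreadPeriod k p M hpM f z, ⟨z, rfl⟩⟩

/-- Unfolding `spreadElt`. [cite: AshStevens1986, §1 (1.3)] -/
theorem coe_spreadElt (z : H1carrier k p M) : (spreadElt k p M hpM f z : GL (Fin 2) (ZMod p) → _) = spreadPeriod k p M hpM f z :=
  rfl

/-- `spreadElt` is additive. [cite: AshStevens1986, §1 (1.3)] -/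
theorem spreadElt_add (z₁ z₂ : H1carrier k p M) :
    spreadElt k p M hpM f (z₁ + z₂) = spreadElt k p M hpM f z₁ + spreadElt k p M hpM f z₂ :=
  Subtype.ext (map_add _ _ _)

/-- `spreadElt` is `k`-homogeneous. [cite: AshStevens1986, §1 (1.3)] -/
theorem spreadElt_smul (c : k) (z : H1carrier k p M) : spreadElt k p M hpM f (c • z) = c • spreadElt k p M hpM f z :=
  Subtype.ext (map_smul _ _ _)

/-- `spreadElt (g·z) = R_g (spreadElt z)`. [cite: AshStevens1986, §1 (1.2)] -/
theorem spreadElt_H1carrierRep (g : GL (Fin 2) (ZMod p)) (z : H1carrier k p M) :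
    spreadElt k p M hpM f (H1carrierRep k p M g z) =
      ⟨funTranslate p g (spreadElt k p M hpM f z).1, spreadLattice_translate_mem k p M hpM f g (spreadElt k p M hpM f z).2⟩ :=
  Subtype.ext (by rw [coe_spreadElt, spreadPeriod, H1carrierRep, PermutationCoeff.spread_H1RightRep]; rfl)

/-- Two invariant classes with the same image in `H(p²M; k)` have the same spread (untwisted hypothesis).
[cite: AshStevens1986, §1 (1.3)] -/
theorem spreadPeriod_eq_of_cuspidal_eq (hK : SpreadKernelHyp k p M hpM f)
    {y₁ y₂ : PermutationCoeff.H1Invariants k (redGL p M) (diagTorus (ZMod p))}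
    (h : torusInvariantsToCuspidal k p M hpM y₁ = torusInvariantsToCuspidal k p M hpM y₂) :
    spreadPeriod k p M hpM f (y₁ : H1carrier k p M) = spreadPeriod k p M hpM f (y₂ : H1carrier k p M) := by
  rw [← sub_eq_zero, ← map_sub, ← Submodule.coe_sub]
  apply hK
  rw [torusPeriodClass, LinearMap.comp_apply, map_sub, h, sub_self, map_zero]

/-- Two invariant classes with the same image in `H(p²M; k)` have the same twisted spread (twisted hypothesis).
[cite: AshStevens1986, §1 (1.3)] -/
theorem spreadPeriod_coeffTwist_eq_of_cuspidal_eq (θ : (ZMod p)ˣ →* kˣ) (hKχ : TwistedSpreadKernelHyp k p M hpM f θ)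
    {y₁ y₂ : PermutationCoeff.H1Invariants k (redGL p M) (diagTorus (ZMod p))}
    (h : torusInvariantsToCuspidal k p M hpM y₁ = torusInvariantsToCuspidal k p M hpM y₂) :
    spreadPeriod k p M hpM f (H1coeffTwist k p M θ (y₁ : H1carrier k p M)) =
      spreadPeriod k p M hpM f (H1coeffTwist k p M θ (y₂ : H1carrier k p M)) := by
  rw [← sub_eq_zero, ← map_sub, ← map_sub, ← Submodule.coe_sub]
  apply hKχ
  rw [map_sub, h, sub_self]

variable [NeZero (p ^ 2 * M)]

/-! ### Lifting `H(p²M; k)` to torus invariants and the transfer maps -/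

/-- A chosen `T̃`-invariant lift of `1 ⊗ φ ∈ H(p²M; k)` through the (onto) dictionary. [cite: AshStevens1986, §1 (1.3)] -/
def liftInv (φ : periodHomologyHecke (p ^ 2 * M)) : PermutationCoeff.H1Invariants k (redGL p M) (diagTorus (ZMod p)) :=
  Classical.choose (torusInvariantsToCuspidal_surjective k p M hpM ((1 : k) ⊗ₜ[ℤ] φ))

/-- `dictionary (liftInv φ) = 1 ⊗ φ`. [cite: AshStevens1986, §1 (1.3)] -/
theorem torusInvariantsToCuspidal_liftInv (φ : periodHomologyHecke (p ^ 2 * M)) :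
    torusInvariantsToCuspidal k p M hpM (liftInv k p M hpM φ) = (1 : k) ⊗ₜ[ℤ] φ :=
  Classical.choose_spec (torusInvariantsToCuspidal_surjective k p M hpM ((1 : k) ⊗ₜ[ℤ] φ))

variable {V : Type} [AddCommGroup V] [Module k V] (σ : Representation k (GL (Fin 2) (ZMod p)) V)
  (Ψ : spreadLattice k p M hpM f →ₗ[k] V)

/-- `Ψ : Λ_Q(f) → V` intertwines right translation of functions with `σ`. [cite: AshStevens1986, §1 (1.2)] -/
def IsEquivariantOnSpread : Prop :=
  ∀ (F : spreadLattice k p M hpM f) (g : GL (Fin 2) (ZMod p)),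
    Ψ ⟨funTranslate p g F.1, spreadLattice_translate_mem k p M hpM f g F.2⟩ = σ g (Ψ F)

/-- **`β_W φ := Ψ(Π_f(lift φ))`.** [cite: AshStevens1986, §1 (1.3)] -/
def transferW (φ : periodHomologyHecke (p ^ 2 * M)) : V :=
  Ψ (spreadElt k p M hpM f (liftInv k p M hpM φ : H1carrier k p M))

/-- **`β_V φ := Ψ(Π_f(M_θ lift φ))`.** [cite: AshStevens1986, §1 (1.3)] -/
def transferV (θ : (ZMod p)ˣ →* kˣ) (φ : periodHomologyHecke (p ^ 2 * M)) : V :=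
  Ψ (spreadElt k p M hpM f (H1coeffTwist k p M θ (liftInv k p M hpM φ : H1carrier k p M)))

/-! ### Well-definedness modulo the spread-kernel hypotheses -/

/-- `β_W` is additive (untwisted hypothesis). [cite: AshStevens1986, §1 (1.3)] -/
theorem transferW_add (hK : SpreadKernelHyp k p M hpM f) (φ₁ φ₂ : periodHomologyHecke (p ^ 2 * M)) :
    transferW k p M hpM f Ψ (φ₁ + φ₂) = transferW k p M hpM f Ψ φ₁ + transferW k p M hpM f Ψ φ₂ := by
  rw [transferW, transferW, transferW, ← map_add, ← spreadElt_add]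
  congr 1
  apply Subtype.ext
  rw [coe_spreadElt, coe_spreadElt, ← Submodule.coe_add]
  apply spreadPeriod_eq_of_cuspidal_eq k p M hpM f hK
  rw [map_add, torusInvariantsToCuspidal_liftInv, torusInvariantsToCuspidal_liftInv, torusInvariantsToCuspidal_liftInv,
    TensorProduct.tmul_add]

/-- `β_V` is additive (twisted hypothesis). [cite: AshStevens1986, §1 (1.3)] -/
theorem transferV_add (θ : (ZMod p)ˣ →* kˣ) (hKχ : TwistedSpreadKernelHyp k p M hpM f θ)
    (φ₁ φ₂ : periodHomologyHecke (p ^ 2 * M)) :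
    transferV k p M hpM f Ψ θ (φ₁ + φ₂) = transferV k p M hpM f Ψ θ φ₁ + transferV k p M hpM f Ψ θ φ₂ := by
  rw [transferV, transferV, transferV, ← map_add, ← spreadElt_add]
  congr 1
  apply Subtype.ext
  rw [coe_spreadElt, coe_spreadElt, ← map_add, ← Submodule.coe_add]
  apply spreadPeriod_coeffTwist_eq_of_cuspidal_eq k p M hpM f θ hKχ
  rw [map_add, torusInvariantsToCuspidal_liftInv, torusInvariantsToCuspidal_liftInv, torusInvariantsToCuspidal_liftInv,
    TensorProduct.tmul_add]

/-- **`φ(f) = 0 ⇒ β_W φ = 0`** (untwisted hypothesis). [cite: AshStevens1986, §1 (1.3); Stevens1989, Lemma (5.4) p. 97] -/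
theorem transferW_eq_zero_of_apply_eq_zero (hK : SpreadKernelHyp k p M hpM f) (φ : periodHomologyHecke (p ^ 2 * M))
    (hφ : (φ : Module.Dual ℂ (CuspForm (Gamma0 (p ^ 2 * M)) 2)) f = 0) : transferW k p M hpM f Ψ φ = 0 := by
  have h0 : spreadPeriod k p M hpM f (liftInv k p M hpM φ : H1carrier k p M) = 0 := by
    apply hK
    rw [torusPeriodClass, LinearMap.comp_apply, torusInvariantsToCuspidal_liftInv, periodClassK_tmul]
    have hz : periodMapLattice (p ^ 2 * M) f φ = 0 := Subtype.ext (by rw [coe_periodMapLattice, periodMap_apply, hφ]; rfl)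
    rw [hz, TensorProduct.tmul_zero]
  rw [transferW, ← map_zero Ψ]
  congr 1
  exact Subtype.ext h0

/-! ### Torus behaviour of `β_W`, `β_V` -/

/-- **`σ(t)(β_W φ) = β_W φ`** for `t ∈ T̃` (`Ψ` equivariant): `β_W` lands in the torus invariants of `V`.
[cite: AshStevens1986, §1 (1.2)] -/
theorem apply_transferW_of_mem_diagTorus (hΨ : IsEquivariantOnSpread k p M hpM f σ Ψ) (φ : periodHomologyHecke (p ^ 2 * M))
    {t : GL (Fin 2) (ZMod p)} (ht : t ∈ diagTorus (ZMod p)) :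
    σ t (transferW k p M hpM f Ψ φ) = transferW k p M hpM f Ψ φ := by
  rw [transferW, ← hΨ, ← spreadElt_H1carrierRep]
  congr 2
  exact (PermutationCoeff.mem_H1Invariants_iff (redGL p M) _ _).1 (liftInv k p M hpM φ).2 ⟨t, ht⟩

/-- **`σ(t)(β_V φ) = θ(det t)·β_V φ`** for `t ∈ T̃`: `β_V` lands in the `θ∘det`-eigenvectors of `V`. [cite: AshStevens1986, §1 (1.2)] -/
theorem apply_transferV_of_mem_diagTorus (hΨ : IsEquivariantOnSpread k p M hpM f σ Ψ) (θ : (ZMod p)ˣ →* kˣ)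
    (φ : periodHomologyHecke (p ^ 2 * M)) {t : GL (Fin 2) (ZMod p)} (ht : t ∈ diagTorus (ZMod p)) :
    σ t (transferV k p M hpM f Ψ θ φ) = detChar k p θ t • transferV k p M hpM f Ψ θ φ := by
  rw [transferV, ← hΨ, ← spreadElt_H1carrierRep, ← map_smul, ← spreadElt_smul]
  congr 2
  exact H1coeffTwist_mem_H1DetEigenspace_of_mem_invariants k p M θ (liftInv k p M hpM φ).2 t ht

/-! ### The twisting relation `β_W(T_χ φ) = Σ_a θ(a)σ(u(a)) β_V φ` -/

variable {χ : DirichletCharacter ℂ p} (hχ : χ.IsQuadratic) (hprim : χ.IsPrimitive)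

include hprim in
/-- **`β_W(T_χ φ) = Σ_a θ(a)·σ(u(a))(β_V φ)`** — the datum field (D5), from the twist comparison of the dictionary (untwisted
spread-kernel hypothesis; `θ` involutive with `θ = χ` in `k`). [cite: Stevens1989, Lemma (5.4) p. 97; AshStevens1986, §1 (1.3)] -/
theorem transferW_twistDown (hΨ : IsEquivariantOnSpread k p M hpM f σ Ψ) (hK : SpreadKernelHyp k p M hpM f)
    (θ : (ZMod p)ˣ →* kˣ) (hθ : ∀ u, θ u * θ u = 1) (hθχ : ∀ w : ZMod p, MulChar.ofUnitHom θ w = (quadInt χ w : k))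
    (φ : periodHomologyHecke (p ^ 2 * M)) :
    transferW k p M hpM f Ψ (twistDown (p ^ 2 * M) (dvd_mul_right (p ^ 2) M) hχ hprim φ) =
      ∑ a : ZMod p, MulChar.ofUnitHom θ a • σ (GL2.upperUnip (ZMod p) a) (transferV k p M hpM f Ψ θ φ) := by
  -- the lift of `T_χ φ` and `twistInvariants (lift φ)` have the same image downstairs
  have hc : torusInvariantsToCuspidal k p M hpM (liftInv k p M hpM (twistDown (p ^ 2 * M) (dvd_mul_right (p ^ 2) M) hχ hprim φ)) =
      torusInvariantsToCuspidal k p M hpM (twistInvariants k p M θ hθ (liftInv k p M hpM φ)) := by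
    rw [torusInvariantsToCuspidal_liftInv, twistComparison p M hpM k θ hθ hχ hprim hθχ, torusInvariantsToCuspidal_liftInv,
      twistDownK_tmul]
  have hs := spreadPeriod_eq_of_cuspidal_eq k p M hpM f hK hc
  rw [coe_twistInvariants, H1coeffTwist_twistUp, twistUp_apply, map_sum] at hs
  rw [transferW]
  have e : spreadElt k p M hpM f (liftInv k p M hpM (twistDown (p ^ 2 * M) (dvd_mul_right (p ^ 2) M) hχ hprim φ) : H1carrier k p M) =
      ∑ a : ZMod p, MulChar.ofUnitHom θ a • (⟨funTranslate p (GL2.upperUnip (ZMod p) a)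
        (spreadElt k p M hpM f (H1coeffTwist k p M θ (liftInv k p M hpM φ : H1carrier k p M))).1,
        spreadLattice_translate_mem k p M hpM f _ (spreadElt k p M hpM f _).2⟩ : spreadLattice k p M hpM f) := by
    apply Subtype.ext
    rw [coe_spreadElt, hs, Submodule.coe_sum]
    refine Finset.sum_congr rfl fun a _ => ?_
    rw [Submodule.coe_smul, map_smul, ← coe_spreadElt k p M hpM f, spreadElt_H1carrierRep]
  rw [e, map_sum]
  refine Finset.sum_congr rfl fun a _ => ?_
  rw [map_smul, hΨ, transferV]

/-! ### The `χ∘det`-line of `range Ψ` is spanned by `β_V(Λ)` -/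

/-- For `y` invariant with `dictionary(y) = Σᵢ cᵢ·({∞,γᵢ∞} ⊗ 1)`: `Π_f(M_θ y) = Σᵢ cᵢ·Π_f(M_θ lift{∞,γᵢ∞})` (twisted hypothesis).
[cite: AshStevens1986, §1 (1.3)] -/
theorem spreadPeriod_coeffTwist_eq_sum (θ : (ZMod p)ˣ →* kˣ) (hKχ : TwistedSpreadKernelHyp k p M hpM f θ)
    (y : PermutationCoeff.H1Invariants k (redGL p M) (diagTorus (ZMod p))) (c : Gamma0 (p ^ 2 * M) →₀ k)
    (hc : torusInvariantsToCuspidal k p M hpM y = c.sum fun γ a => a • Literature.NumberTheory.ModularSymbols.symbol (p ^ 2 * M) k γ) :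
    spreadPeriod k p M hpM f (H1coeffTwist k p M θ (y : H1carrier k p M)) =
      c.sum fun γ a => a • spreadPeriod k p M hpM f (H1coeffTwist k p M θ (liftInv k p M hpM (symbolInt (p ^ 2 * M) γ) : H1carrier k p M)) := by
  have h := spreadPeriod_coeffTwist_eq_of_cuspidal_eq k p M hpM f θ hKχ (y₁ := y)
    (y₂ := c.sum fun γ a => a • liftInv k p M hpM (symbolInt (p ^ 2 * M) γ)) (by
      rw [hc]
      simp only [Finsupp.sum, map_sum, map_smul, torusInvariantsToCuspidal_liftInv,
        Literature.NumberTheory.ModularSymbols.symbol_def])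
  rw [h]
  simp only [Finsupp.sum, Submodule.coe_sum, Submodule.coe_smul, map_sum, map_smul]

/-- **`|T̃|·v ∈ k·β_V(Λ)`** for every `v = Ψ F` on which the model projector `Σ_t θ(det t)σ(t⁻¹)` acts by `|T̃|` (e.g. every
`θ∘det`-torus-eigenvector in `range Ψ`): from the carrier projector `P_θ`, `M_θ`, and the twisted hypothesis.
[cite: Serre1977, §2.6; AshStevens1986, §1 (1.3)] -/
theorem card_smul_mem_span_transferV (hΨ : IsEquivariantOnSpread k p M hpM f σ Ψ) (θ : (ZMod p)ˣ →* kˣ)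
    (hθ : ∀ u, θ u * θ u = 1) (hKχ : TwistedSpreadKernelHyp k p M hpM f θ) (F : spreadLattice k p M hpM f)
    (hv : ∑ t : diagTorus (ZMod p), detChar k p θ t • σ ((t : GL (Fin 2) (ZMod p))⁻¹) (Ψ F) =
      (Fintype.card (diagTorus (ZMod p)) : k) • Ψ F) :
    (Fintype.card (diagTorus (ZMod p)) : k) • Ψ F ∈
      Submodule.span k (Set.range (transferV k p M hpM f Ψ θ)) := by
  obtain ⟨z, hz⟩ : ∃ z : H1carrier k p M, spreadElt k p M hpM f z = F := by
    obtain ⟨z, hz⟩ := F.2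
    exact ⟨z, Subtype.ext hz⟩
  -- `|T̃|·Ψ F = Ψ(Π_f(P_θ z))`
  have hF1 : spreadPeriod k p M hpM f z = F.1 := congrArg Subtype.val hz
  have h1 : (Fintype.card (diagTorus (ZMod p)) : k) • Ψ F = Ψ (spreadElt k p M hpM f (eigProj k p M θ z)) := by
    have e : spreadElt k p M hpM f (eigProj k p M θ z) = ∑ t : diagTorus (ZMod p), detChar k p θ t •
        (⟨funTranslate p ((t : GL (Fin 2) (ZMod p))⁻¹) F.1, spreadLattice_translate_mem k p M hpM f _ F.2⟩ :
          spreadLattice k p M hpM f) := by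
      apply Subtype.ext
      rw [coe_spreadElt, spreadPeriod_eigProj, funProj, Submodule.coe_sum, hF1]
      refine Finset.sum_congr rfl fun t _ => ?_
      rw [Submodule.coe_smul]
    rw [← hv, e, map_sum]
    refine Finset.sum_congr rfl fun t _ => ?_
    rw [map_smul, hΨ]
  -- `P_θ z = M_θ y` with `y` invariant
  have hy : H1coeffTwist k p M θ (eigProj k p M θ z) ∈ PermutationCoeff.H1Invariants k (redGL p M) (diagTorus (ZMod p)) :=
    H1coeffTwist_mem_invariants_of_mem_H1DetEigenspace k p M θ θ hθ (eigProj_mem_H1DetEigenspace k p M θ z)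
  have h2 : eigProj k p M θ z = H1coeffTwist k p M θ
      ((⟨H1coeffTwist k p M θ (eigProj k p M θ z), hy⟩ : PermutationCoeff.H1Invariants k (redGL p M) (diagTorus (ZMod p))) :
        H1carrier k p M) := (H1coeffTwist_H1coeffTwist_of_mul_self k p M θ hθ _).symm
  -- decompose the image of `y` downstairs into symbols
  obtain ⟨c, hc⟩ := (Finsupp.mem_span_range_iff_exists_finsupp.1
    (by rw [Literature.NumberTheory.ModularSymbols.span_range_symbol]; exact Submodule.mem_top :
      torusInvariantsToCuspidal k p M hpM ⟨H1coeffTwist k p M θ (eigProj k p M θ z), hy⟩ ∈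
        Submodule.span k (Set.range (Literature.NumberTheory.ModularSymbols.symbol (p ^ 2 * M) k))))
  rw [h1, h2]
  have h3 := spreadPeriod_coeffTwist_eq_sum k p M hpM f θ hKχ ⟨_, hy⟩ c hc.symm
  have e : spreadElt k p M hpM f (H1coeffTwist k p M θ
      ((⟨H1coeffTwist k p M θ (eigProj k p M θ z), hy⟩ : PermutationCoeff.H1Invariants k (redGL p M) (diagTorus (ZMod p))) :
        H1carrier k p M)) =
      ∑ γ ∈ c.support, c γ • spreadElt k p M hpM f
        (H1coeffTwist k p M θ (liftInv k p M hpM (symbolInt (p ^ 2 * M) γ) : H1carrier k p M)) := by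
    apply Subtype.ext
    rw [coe_spreadElt, h3, Submodule.coe_sum]
    rfl
  rw [e, map_sum]
  refine Submodule.sum_mem _ fun γ _ => ?_
  rw [map_smul]
  exact Submodule.smul_mem _ _ (Submodule.subset_span ⟨symbolInt (p ^ 2 * M) γ, rfl⟩)

end FullLevel

end Literature.NumberTheory.ModularSymbols
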